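import Mathlib
import Summits.MatrixMultiplication.MatrixMultiplication.Theses.LevelGradedCohnUmans

/-!
# `SnLevelDesigns` (stmt-MatrixMultiplication-7613), line `garnir-annihilator`:
# S1 `stub_garnirVanishing` — Garnir vanishing (the lever)

Crux `Summit.MatrixMultiplication.MatrixMultiplication.Theses.LevelGradedCohnUmans.SnLevelDesigns`;
skeleton `Cruxes/SnLevelDesigns/Lines/garnir-annihilator.lean` (lead reshape, 7 registered stubs);
this file proves the registered stub `stub_garnirVanishing` verbatim (name + signature, tree-only
vocabulary) and lands `--supports stmt-MatrixMultiplication-7613`.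

For a block labelling `blk : Fin n → Fin n` (blocks = fibres) of EXCESS `≥ k+1`
(`#image blk + k + 1 ≤ n`), every `k`-token coefficient table `c` and all `a b ∈ 𝔖ₙ`, the signed
sum of the token function `g ↦ Σ_p c p (g ∘ p)` over the two-sided translate `a · S_blk · b` of
the Young subgroup `S_blk = {σ | blk ∘ σ = blk}` vanishes. Proof: swap the sums; for a fixed
tuple `p` the tuple `b ∘ p` has `≤ k` values while the blocks have total excess `≥ k+1`, so some
block holds two points `u ≠ v` outside `range (b ∘ p)`; `σ ↦ σ * swap u v` is a sign-reversing
involution of `S_blk` fixing `(a σ b) ∘ p`. Generalises `Negative`/`Disproof`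
`sum_sign_mul_tokenFn` (one block) and `sum_coset_sign_mul_tokenFn` (cubes).
-/

set_option linter.dupNamespace false

namespace Summit.MatrixMultiplication.MatrixMultiplication.Theorems.SnLevelDesigns

open scoped BigOperators

/-- **`stub_garnirVanishing`** (registered stub of crux stmt-MatrixMultiplication-7613, line
`garnir-annihilator`; Garnir vanishing, the lever). For a block labelling `blk : Fin n → Fin n`
(blocks = fibres of `blk`) of excess `≥ k + 1`, i.e. `#image blk + k + 1 ≤ n`, every `k`-token
coefficient table `c` and all `a b : Equiv.Perm (Fin n)`, the signed sum of the token function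
`g ↦ ∑ p, c p (g ∘ p)` over the two-sided translate `a · S_blk · b` of the Young subgroup
`S_blk = {σ | ∀ x, blk (σ x) = blk x}` vanishes. Proof: swap the two sums; for a fixed tuple `p`
the finset `image (b ∘ p)` has `≤ k` points, its complement has `> #image blk` points, so
(pigeonhole) one block contains two points `u ≠ v` off `image (b ∘ p)`; then `σ ↦ σ * swap u v`
is a fixed-point-free sign-reversing involution of `S_blk` leaving `(a * σ * b) ∘ p` unchanged,
and `Finset.sum_involution` concludes. -/
theorem stub_garnirVanishing :
    ∀ (n k : ℕ) (blk : Fin n → Fin n), (Finset.univ.image blk).card + k + 1 ≤ n →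
      ∀ (c : (Fin k → Fin n) → (Fin k → Fin n) → ℂ) (a b : Equiv.Perm (Fin n)),
        (∑ σ ∈ Finset.univ.filter (fun σ : Equiv.Perm (Fin n) => ∀ x, blk (σ x) = blk x),
          ((Equiv.Perm.sign σ : ℤ) : ℂ) * ∑ p : Fin k → Fin n, c p (⇑(a * σ * b) ∘ p)) = 0 := by
  intro n k blk hexc c a b
  classical
  simp_rw [Finset.mul_sum]
  rw [Finset.sum_comm]
  refine Finset.sum_eq_zero fun p _ => ?_
  -- `R` := the values of the tuple `b ∘ p`; its complement is larger than the set of blocks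
  set R : Finset (Fin n) := Finset.univ.image (⇑b ∘ p) with hR
  have hRcard : R.card ≤ k := by
    calc R.card ≤ (Finset.univ : Finset (Fin k)).card := Finset.card_image_le
      _ = k := by simp
  have hlt : (Finset.univ.image blk).card < Rᶜ.card := by
    rw [Finset.card_compl, Fintype.card_fin]
    omega
  obtain ⟨u, hu, v, hv, huv, hblk⟩ := Finset.exists_ne_map_eq_of_card_lt_of_maps_to hlt
    (f := blk) (fun x _ => Finset.mem_image_of_mem blk (Finset.mem_univ x))
  have hpu : ∀ i, b (p i) ≠ u := fun i h => by
    have : u ∈ R := Finset.mem_image.mpr ⟨i, Finset.mem_univ _, h⟩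
    exact (Finset.mem_compl.mp hu) this
  have hpv : ∀ i, b (p i) ≠ v := fun i h => by
    have : v ∈ R := Finset.mem_image.mpr ⟨i, Finset.mem_univ _, h⟩
    exact (Finset.mem_compl.mp hv) this
  set τ : Equiv.Perm (Fin n) := Equiv.swap u v with hτ
  -- `blk` is constant on `{u, v}`, hence `τ`-invariant
  have hblkτ : ∀ x, blk (τ x) = blk x := by
    intro x
    rcases eq_or_ne x u with rfl | hxu
    · rw [hτ, Equiv.swap_apply_left]; exact hblk.symm
    rcases eq_or_ne x v with rfl | hxv
    · rw [hτ, Equiv.swap_apply_right]; exact hblk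
    · rw [hτ, Equiv.swap_apply_of_ne_of_ne hxu hxv]
  -- `σ ↦ σ * τ` is a fixed-point-free sign-reversing involution of the Young subgroup
  refine Finset.sum_involution (fun σ _ => σ * τ) ?_ ?_ ?_ ?_
  · intro σ _
    have hcomp : (⇑(a * (σ * τ) * b) ∘ p : Fin k → Fin n) = ⇑(a * σ * b) ∘ p := by
      funext i
      simp [hτ, Equiv.swap_apply_of_ne_of_ne (hpu i) (hpv i)]
    have hsign : ((Equiv.Perm.sign (σ * τ) : ℤ) : ℂ) = -((Equiv.Perm.sign σ : ℤ) : ℂ) := by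
      rw [Equiv.Perm.sign_mul, hτ, Equiv.Perm.sign_swap huv]
      push_cast
      ring
    rw [hcomp, hsign]
    ring
  · intro σ _ _ h
    apply huv
    have h1 : σ * τ = σ * 1 := by rw [mul_one]; exact h
    have h2 : τ = 1 := mul_left_cancel h1
    rw [hτ] at h2
    exact Equiv.swap_eq_one_iff.mp h2
  · intro σ hσ
    simp only [Finset.mem_filter, Finset.mem_univ, true_and] at hσ ⊢
    intro x
    rw [Equiv.Perm.mul_apply, hσ, hblkτ]
  · intro σ _
    rw [mul_assoc, hτ, Equiv.swap_mul_self, mul_one]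

end Summit.MatrixMultiplication.MatrixMultiplication.Theorems.SnLevelDesigns
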